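import Summits.CriticalPhenomena.PercolationContinuityZ3.Theorems.PercFiniteBoxLRORenormaliseFromLinearLROBlockDefs

/-!
# `stub_denseMarkovPointwise` of line `registered` (crux `PercFiniteBoxLRO.RenormaliseFromLinearLRO`,
# stmt-CriticalPhenomena-0857, reshape 2): the deterministic half of the second-moment boost

Registered stub `stub_denseMarkovPointwise` of the lead's skeleton.  Notation (objects file
`…BlockDefs.lean`, p156138): `G = coreGrid s m` (grid points of the core `Λ(n)`, `n = (2s+1)m`, pairwise
`≥ 2s+1` apart), `S = Λ(K n)`, `X = largeCount s G ω` (locally-large grid points: `ω ∈ armEvent y s`),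
`deg x = joinedCount s S G x ω` (those also joined to `x` inside `S`), `Y = Σ_{y,y' ∈ G} 1[ω ∈ openConnIn S y y']`
(ordered pairs of grid points joined inside `S`), `F = {∀ x, 12·deg x < 11·X}` ("no base point captures
`11/12` of the locally-large grid points").

* (A) for a lattice configuration `ω ⊆ E(ℤ³)`: `12·Y ≤ 12·|G| + 12·X² − 1_F·X²`.  Two DISTINCT grid points
  joined inside `S` are both locally large (the joining path leaves `y + Λ(s)` since distinct grid points
  differ by `≥ 2s+1 > s` in some coordinate; first exit, `DCT16.armEvent_of_pathIn`), so the inner sum over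
  `y'` is `≤ 1 + 1[y large]·deg y` (`markov_innerSum_le`), and `deg y ≤ X` always while `12·deg y ≤ 11·X`
  on `F` (`markov_pairSum_le`).
* (E) if `ω` is not dense then `F` holds or some half-grid `G_j` has `6·X_j ≤ X`: otherwise pick `x` with
  `12·deg x ≥ 11·X`; for every half-grid, `largeSet_j ∪ joinedSet_G(x) ⊆ largeSet_G` and
  `largeSet_j ∩ joinedSet_G(x) ⊆ joinedSet_j(x)`, so `X_j + deg x ≤ J_j + X` (`Finset.card_union_add_card_inter`),
  and with `X < 6 X_j` this forces `X_j < 2 J_j`, i.e. `ω` is dense with base point `x` — contradiction.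

Pure theorem file; lands `--supports stmt-CriticalPhenomena-0857`.
-/

noncomputable section

namespace Summit.CriticalPhenomena.PercolationContinuityZ3.Theorems.RenormaliseFromLinearLRO

open Literature.Probability.Percolation Literature.Probability.LatticeModels
open MeasureTheory

/-! ## Distinct grid points joined inside a region are locally large -/

/-- Distinct core grid points differ by more than `s` in some coordinate: `y' - y ∉ Λ(s)`. -/
theorem markov_sub_notMem_box {s m : ℕ} {y y' : Site 3} (hy : y ∈ coreGrid s m)
    (hy' : y' ∈ coreGrid s m) (hne : y ≠ y') : y' - y ∉ box 3 s := by
  obtain ⟨z, -, rfl⟩ := mem_coreGrid.1 hy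
  obtain ⟨z', -, rfl⟩ := mem_coreGrid.1 hy'
  obtain ⟨i, hi⟩ := exists_le_abs_sub_of_ne (s := s) (z := z') (z' := z) (Ne.symm hne)
  rw [mem_box, not_forall]
  refine ⟨i, fun h => ?_⟩
  simp only [Pi.sub_apply] at h
  have habs : |gridPt s z' i - gridPt s z i| ≤ s := abs_le.2 h
  push_cast at hi
  omega

/-- A grid point joined inside any region `S` to a DISTINCT grid point is locally large at scale `s`
(first exit of the joining path from `y + Λ(s)`; lattice configurations). -/
theorem markov_armEvent_of_openConnIn {s m : ℕ} {ω : BondConfig (Site 3)}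
    (hω : ω ⊆ (zdGraph 3).edgeSet) {S : Set (Site 3)} {y y' : Site 3} (hy : y ∈ coreGrid s m)
    (hy' : y' ∈ coreGrid s m) (hne : y ≠ y') (h : ω ∈ openConnIn S y y') :
    ω ∈ DCT16.armEvent y s :=
  DCT16.armEvent_of_pathIn hω (DCT16.pathIn_of_mem_openConnIn h)
    (Or.inl (markov_sub_notMem_box hy hy' hne))

/-! ## (A) The pair count against the locally-large count -/

/-- The inner sum: for a grid point `y`, the number of grid points joined to `y` inside `S` is at most
`1 + 1[y large]·deg y` (the diagonal term, plus: a distinct joined grid point is large, `y` is large, so the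
point is counted by `joinedCount s S G y`). -/
theorem markov_innerSum_le {s m : ℕ} {ω : BondConfig (Site 3)} (hω : ω ⊆ (zdGraph 3).edgeSet)
    (S : Set (Site 3)) {y : Site 3} (hy : y ∈ coreGrid s m) :
    ∑ y' ∈ coreGrid s m, (openConnIn S y y').indicator (fun _ => (1 : ℝ)) ω ≤
      1 + (DCT16.armEvent y s).indicator (fun _ => (1 : ℝ)) ω * (joinedCount s S (coreGrid s m) y ω : ℝ) := by
  classical
  rw [joinedCount_eq_sum_indicator, Finset.mul_sum]
  have hterm : ∀ y' ∈ coreGrid s m, (openConnIn S y y').indicator (fun _ => (1 : ℝ)) ω ≤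
      (if y' = y then (1 : ℝ) else 0) +
        (DCT16.armEvent y s).indicator (fun _ => (1 : ℝ)) ω *
          (DCT16.armEvent y' s ∩ openConnIn S y y').indicator (fun _ => (1 : ℝ)) ω := by
    intro y' hy'
    by_cases hc : ω ∈ openConnIn S y y'
    · rw [Set.indicator_of_mem hc]
      by_cases hyy : y' = y
      · rw [if_pos hyy]
        have h0 : 0 ≤ (DCT16.armEvent y s).indicator (fun _ => (1 : ℝ)) ω *
            (DCT16.armEvent y' s ∩ openConnIn S y y').indicator (fun _ => (1 : ℝ)) ω :=
          mul_nonneg (Set.indicator_nonneg (fun _ _ => zero_le_one) _)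
            (Set.indicator_nonneg (fun _ _ => zero_le_one) _)
        linarith
      · rw [if_neg hyy]
        have hly : ω ∈ DCT16.armEvent y s := markov_armEvent_of_openConnIn hω hy hy' (Ne.symm hyy) hc
        have hly' : ω ∈ DCT16.armEvent y' s :=
          markov_armEvent_of_openConnIn hω hy' hy hyy (openConnIn_reverse hc)
        rw [Set.indicator_of_mem hly, Set.indicator_of_mem (Set.mem_inter hly' hc)]
        norm_num
    · rw [Set.indicator_of_notMem hc]
      have h1 : 0 ≤ (if y' = y then (1 : ℝ) else 0) := by split_ifs <;> norm_num
      have h2 : 0 ≤ (DCT16.armEvent y s).indicator (fun _ => (1 : ℝ)) ω *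
          (DCT16.armEvent y' s ∩ openConnIn S y y').indicator (fun _ => (1 : ℝ)) ω :=
        mul_nonneg (Set.indicator_nonneg (fun _ _ => zero_le_one) _)
          (Set.indicator_nonneg (fun _ _ => zero_le_one) _)
      linarith
  calc ∑ y' ∈ coreGrid s m, (openConnIn S y y').indicator (fun _ => (1 : ℝ)) ω
      ≤ ∑ y' ∈ coreGrid s m, ((if y' = y then (1 : ℝ) else 0) +
          (DCT16.armEvent y s).indicator (fun _ => (1 : ℝ)) ω *
            (DCT16.armEvent y' s ∩ openConnIn S y y').indicator (fun _ => (1 : ℝ)) ω) :=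
        Finset.sum_le_sum hterm
    _ = 1 + ∑ y' ∈ coreGrid s m, (DCT16.armEvent y s).indicator (fun _ => (1 : ℝ)) ω *
            (DCT16.armEvent y' s ∩ openConnIn S y y').indicator (fun _ => (1 : ℝ)) ω := by
        rw [Finset.sum_add_distrib, Finset.sum_ite_eq' (coreGrid s m) y (fun _ => (1 : ℝ)), if_pos hy]

/-- The pair count against a uniform bound `c` on the degrees: if `deg y ≤ c` for every grid point `y`
then `Y ≤ |G| + c·X`. -/
theorem markov_pairSum_le {s m : ℕ} {ω : BondConfig (Site 3)} (hω : ω ⊆ (zdGraph 3).edgeSet)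
    (S : Set (Site 3)) {c : ℝ} (hc : ∀ y ∈ coreGrid s m, (joinedCount s S (coreGrid s m) y ω : ℝ) ≤ c) :
    ∑ y ∈ coreGrid s m, ∑ y' ∈ coreGrid s m, (openConnIn S y y').indicator (fun _ => (1 : ℝ)) ω ≤
      ((coreGrid s m).card : ℝ) + c * (largeCount s (coreGrid s m) ω : ℝ) := by
  have hterm : ∀ y ∈ coreGrid s m,
      ∑ y' ∈ coreGrid s m, (openConnIn S y y').indicator (fun _ => (1 : ℝ)) ω ≤
        1 + c * (DCT16.armEvent y s).indicator (fun _ => (1 : ℝ)) ω := by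
    intro y hy
    refine (markov_innerSum_le hω S hy).trans ?_
    have hind : 0 ≤ (DCT16.armEvent y s).indicator (fun _ => (1 : ℝ)) ω :=
      Set.indicator_nonneg (fun _ _ => zero_le_one) _
    have := mul_le_mul_of_nonneg_left (hc y hy) hind
    linarith [this]
  calc ∑ y ∈ coreGrid s m, ∑ y' ∈ coreGrid s m, (openConnIn S y y').indicator (fun _ => (1 : ℝ)) ω
      ≤ ∑ y ∈ coreGrid s m, (1 + c * (DCT16.armEvent y s).indicator (fun _ => (1 : ℝ)) ω) :=
        Finset.sum_le_sum hterm
    _ = ((coreGrid s m).card : ℝ) + c * (largeCount s (coreGrid s m) ω : ℝ) := by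
        rw [Finset.sum_add_distrib, Finset.sum_const, nsmul_eq_mul, mul_one, largeCount_eq_sum_indicator,
          Finset.mul_sum]

/-- **(A)** `12·Y ≤ 12·|G| + 12·X² − 1_F·X²` for lattice configurations. -/
theorem markov_twelve_pairSum_le (K s m : ℕ) {ω : BondConfig (Site 3)} (hω : ω ⊆ (zdGraph 3).edgeSet) :
    12 * (∑ y ∈ coreGrid s m, ∑ y' ∈ coreGrid s m,
        (openConnIn (↑(box 3 (K * ((2 * s + 1) * m))) : Set (Site 3)) y y').indicator
          (fun _ => (1 : ℝ)) ω) ≤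
      12 * ((coreGrid s m).card : ℝ) + 12 * (largeCount s (coreGrid s m) ω : ℝ) ^ 2 -
        {ω' : BondConfig (Site 3) | ∀ x : Site 3,
            12 * joinedCount s ↑(box 3 (K * ((2 * s + 1) * m))) (coreGrid s m) x ω' <
              11 * largeCount s (coreGrid s m) ω'}.indicator
          (fun ω' => (largeCount s (coreGrid s m) ω' : ℝ) ^ 2) ω := by
  set S : Set (Site 3) := ↑(box 3 (K * ((2 * s + 1) * m))) with hS
  set F : Set (BondConfig (Site 3)) := {ω' : BondConfig (Site 3) | ∀ x : Site 3,
      12 * joinedCount s S (coreGrid s m) x ω' < 11 * largeCount s (coreGrid s m) ω'} with hF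
  set X : ℝ := (largeCount s (coreGrid s m) ω : ℝ) with hX
  have hX0 : 0 ≤ X := by rw [hX]; positivity
  by_cases hmem : ω ∈ F
  · -- on F every degree is ≤ 11 X / 12
    rw [Set.indicator_of_mem hmem]
    have hc : ∀ y ∈ coreGrid s m, (joinedCount s S (coreGrid s m) y ω : ℝ) ≤ 11 * X / 12 := by
      intro y _
      have h := hmem y
      have h' : (12 * joinedCount s S (coreGrid s m) y ω : ℝ) < 11 * largeCount s (coreGrid s m) ω := by
        exact_mod_cast h
      rw [hX]
      linarith
    have h := markov_pairSum_le hω S (c := 11 * X / 12) hc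
    nlinarith [h]
  · -- off F every degree is ≤ X
    rw [Set.indicator_of_notMem hmem]
    have hc : ∀ y ∈ coreGrid s m, (joinedCount s S (coreGrid s m) y ω : ℝ) ≤ X := by
      intro y _
      rw [hX]
      exact_mod_cast joinedCount_le_largeCount s S (coreGrid s m) y ω
    have h := markov_pairSum_le hω S (c := X) hc
    nlinarith [h]

/-! ## (E) Off the dense block: `F`, or a sparse half-grid -/

/-- Cardinality bookkeeping for a half-grid `G_j ⊆ G` and a base point `x`:
`X_j + deg x ≤ J_j(x) + X` (`largeSet_j ∪ joinedSet_G(x) ⊆ largeSet_G` and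
`largeSet_j ∩ joinedSet_G(x) ⊆ joinedSet_j(x)`, then `Finset.card_union_add_card_inter`). -/
theorem markov_card_half_le {s : ℕ} (S : Set (Site 3)) {G Gj : Finset (Site 3)} (hGj : Gj ⊆ G)
    (x : Site 3) (ω : BondConfig (Site 3)) :
    largeCount s Gj ω + joinedCount s S G x ω ≤ joinedCount s S Gj x ω + largeCount s G ω := by
  set A := largeSet s Gj ω with hA
  set B := joinedSet s S G x ω with hB
  have hunion : A ∪ B ⊆ largeSet s G ω := by
    intro y hy
    rcases Finset.mem_union.1 hy with h | h
    · exact largeSet_mono s hGj ω h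
    · exact joinedSet_subset_largeSet s S G x ω h
  have hinter : A ∩ B ⊆ joinedSet s S Gj x ω := by
    intro y hy
    obtain ⟨h1, h2⟩ := Finset.mem_inter.1 hy
    obtain ⟨hyj, hl⟩ := mem_largeSet.1 h1
    obtain ⟨-, -, hj⟩ := mem_joinedSet.1 h2
    exact mem_joinedSet.2 ⟨hyj, hl, hj⟩
  have h := Finset.card_union_add_card_inter A B
  have h1 := Finset.card_le_card hunion
  have h2 := Finset.card_le_card hinter
  simp only [largeCount, joinedCount, ← hA, ← hB] at *
  omega

/-- **(E)** If `ω` is not dense, then either no base point captures `11/12` of the locally-large core grid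
points, or some half-grid carries at most a sixth of them. -/
theorem markov_notMem_denseBox (K s m : ℕ) {ω : BondConfig (Site 3)} (hω : ω ∉ denseBox K s m) :
    (∀ x : Site 3, 12 * joinedCount s ↑(box 3 (K * ((2 * s + 1) * m))) (coreGrid s m) x ω <
        11 * largeCount s (coreGrid s m) ω) ∨
      ∃ (i : Fin 2) (b : Bool), 6 * largeCount s (halfGrid s m i b) ω ≤ largeCount s (coreGrid s m) ω := by
  by_contra h
  push Not at h
  obtain ⟨⟨x, hx⟩, hhalf⟩ := h
  apply hω
  refine ⟨x, fun i b => ?_⟩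
  have h1 := markov_card_half_le (s := s) (↑(box 3 (K * ((2 * s + 1) * m))) : Set (Site 3))
    (halfGrid_subset_coreGrid s m i b) x ω
  have h2 := joinedCount_le_largeCount s (↑(box 3 (K * ((2 * s + 1) * m))) : Set (Site 3)) (coreGrid s m) x ω
  have h3 := hhalf i b
  omega

/-! ## The registered stub -/

/-- **Registered stub `stub_denseMarkovPointwise` of crux stmt-CriticalPhenomena-0857 (line `registered`,
reshape 2)**: the deterministic half of the second-moment boost — (A) `12·Y ≤ 12·|G| + 12·X² − 1_F·X²` for
lattice configurations, and (E) off the dense block, `F` holds or some half-grid carries at most a sixth of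
the locally-large core grid points. -/
theorem stub_denseMarkovPointwise :
    ∀ (K s m : ℕ) (ω : BondConfig (Site 3)),
      (ω ⊆ (zdGraph 3).edgeSet →
        12 * (∑ y ∈ coreGrid s m, ∑ y' ∈ coreGrid s m,
            (openConnIn (↑(box 3 (K * ((2 * s + 1) * m))) : Set (Site 3)) y y').indicator
              (fun _ => (1 : ℝ)) ω) ≤
          12 * ((coreGrid s m).card : ℝ) + 12 * (largeCount s (coreGrid s m) ω : ℝ) ^ 2 -
            {ω' : BondConfig (Site 3) | ∀ x : Site 3,
                12 * joinedCount s ↑(box 3 (K * ((2 * s + 1) * m))) (coreGrid s m) x ω' <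
                  11 * largeCount s (coreGrid s m) ω'}.indicator
              (fun ω' => (largeCount s (coreGrid s m) ω' : ℝ) ^ 2) ω) ∧
      (ω ∉ denseBox K s m →
        (∀ x : Site 3, 12 * joinedCount s ↑(box 3 (K * ((2 * s + 1) * m))) (coreGrid s m) x ω <
            11 * largeCount s (coreGrid s m) ω) ∨
        ∃ (i : Fin 2) (b : Bool), 6 * largeCount s (halfGrid s m i b) ω ≤ largeCount s (coreGrid s m) ω) :=
  fun K s m _ω => ⟨fun hω => markov_twelve_pairSum_le K s m hω, fun hω => markov_notMem_denseBox K s m hω⟩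

end Summit.CriticalPhenomena.PercolationContinuityZ3.Theorems.RenormaliseFromLinearLRO

end
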